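import Literature.MathematicalPhysics.QuantumFieldTheory.Balaban1983to89.B8Eq137QjEqBRec
import Literature.MathematicalPhysics.QuantumFieldTheory.Balaban1983to89.B8Ineq172ConcreteRec
import Literature.MathematicalPhysics.QuantumFieldTheory.Balaban1983to89.B7LocalityRec
import Literature.MathematicalPhysics.QuantumFieldTheory.Balaban1983to89.BlockAveragingZdCovariance
import Literature.MathematicalPhysics.QuantumFieldTheory.Balaban1983to89.B8Eq142KLevelLocal

/-!
# `Balaban1983to89.B8Eq142KLevelLocalRec` — RECORD TWIN of `B8Eq142KLevelLocal` §1∕§2∕§5 ([Balaban1985RegularSpaces] Theorem 4's auxiliary condition (1.42)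
# «|Q_j(U₀, ηA)| < 2dLα₁» AT ONE CONSTRAINT BOND FROM BOX DATA — interior, crossing and mirrored-crossing bonds) FOR THE SYMMETRISED CENTRED block averaging (0.4) of
# [Balaban1987RG1], with the RECORD's Prop-4 regime

statement-level skeleton of published theorems with citation tags; proofs where landed; nothing here is a claim about the Yang–Mills mass gap

T. Bałaban, *Spaces of regular gauge field configurations on a lattice and gauge fixing conditions*, Commun. Math. Phys. **99** (1985) 75–102 `[Balaban1985RegularSpaces]`
("[6]"): (1.42) p. 83, (1.37) + (1.30)–(1.31) p. 82, (1.35) p. 82, (1.33)–(1.34) p. 82; T. Bałaban, *Averaging operations for lattice gauge theories*, Commun. Math. Phys. **98**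
(1985) 17–51 `[Balaban1985Averaging]` ("[3]"): p. 24 (locality after (43)), (11) p. 19, (87) p. 31, (127) p. 37, Prop. 2 p. 25, Prop. 4 p. 38; T. Bałaban, *Renormalization group
approach to lattice gauge field theories. I*, Commun. Math. Phys. **109** (1987) 249–301 `[Balaban1987RG1]` ("[I]"): (0.3)–(0.4) pp. 252–253, (0.6) p. 253.  STATUS: published.

CITATION HEADER (lean-in-tree rule).  Cell `pub-ymgap`, «N05-REC» stage 2 (director-ym №254∕№255∕№265∕№267∕№288), item R5 sub-chain β, head 3 — typed by the LEAD PEN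
dag-n05-e g38 on dag-n05-c's recipe (inventory `N05-REC-INVENTORY.md` §R5 row `B8Eq142KLevelLocal`: class A = `norm_Qj_lt_interior_loc norm_Qj_lt_crossing_loc
norm_Qj_lt_crossing_mirrored_loc`).  WHAT IS REPRODUCED = ✓`B8Eq142KLevelLocal` §1 (box geometry, CENTRED: the bond box `B^{j}(c₋) ∪ B^{j}(c₊) = [Lʲy − c_j𝟙, Lʲy + Lʲe_κ +
c_j𝟙]` of `B7LocalityRec`, the block towers `B8Ineq130Rec.tlo ∕ thi`), §2 and §5 over `B8Eq137QjEqBRec` (the global record forms), `B7LocalityRec.{logCovIterZ_congr,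
avgIterZ_congr, inBox_nestZ}`, `B8Ineq172ConcreteRec.wrecZ_congr_tower`, `B7Eq123GeneralRec.{dbavgCovIterZ_eq_expCfg_logCovIterZ, level_dataZ}` and — the record's structural
bonus — the UNCONDITIONAL gauge covariance (11) of the (0.4) average `BlockAveragingZdCovariance.avgIterZ_gaugeAct_units` (the engine needs [3] Prop. 2's regime for it).
TOKEN MAP: `logCovIter ∕ avgIter ∕ wrec ↦ logCovIterZ ∕ avgIterZ ∕ wrecZ`; corner boxes `[loK, bondHiK]`, blocks `[L•y, L•y + blockTop L]`, towers `B8Ineq130.tlo ∕ thi` ↦ centred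
boxes, blocks `[L•y − halfVec L, L•y + halfVec L]`, towers `B8Ineq130Rec.tlo ∕ thi`; the engine's Prop-4 regime ↦ the record's (odd `L = 2s+1`, `1 ≤ s`, `1 ≤ d`, `AvgClosedZ`,
`C0Z`, `e^{4cZ·α₀}(1 + 2C₁KZ²·Lᵏb) ≤ 2`, `KZ·Lᵏb ≤ c₃`).  Declaration names = engine names (T5).  The engine's §3∕§4∕§6 (`H42_interior_of_inAx`, `thm4_exists_all_levels_of_b9_interior`,
`H42_of_inAx`) are superseded by the γ edition (`B8Eq142KLevelLocalGamma.H42_of_inAx_γ`, twinned next) and not twinned here.  Kind «kernel-checked proof», theorems only; no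
`def`, no `instance`, no `notation`, no existing module modified.  `--supports stmt-QuantumFields-20541` (K0⁷-keyed, COUNT-NEUTRAL).

HONEST SCOPE: tower-local forms of the record (1.37)∕(1.42) theorems by clamping and locality; nothing of Bałaban's analysis re-proved; `HThm4Rec` UNDISCHARGED; caveat
(C-S3-1) + addendum v4 stand; N05 [B8] DISCHARGED OF RECORD untouched; COUNT of record unmoved · K numerically unchanged; one finite `𝕋⁴` programme at fixed `ε`, Bałaban AS
PRINTED; nothing continuum ∕ ℝ⁴ ∕ OS ∕ mass-gap ∕ Clay.  No `sorry`, no `def`.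

[cite: Balaban1985RegularSpaces, (1.42) p.83, (1.37) p.82, (1.35) p.82; Balaban1985Averaging, p.24, (11) p.19, (87) p.31, (127) p.37; Balaban1987RG1, (0.3)–(0.4) pp.252–253]
-/

noncomputable section

open NormedSpace

namespace Literature.MathematicalPhysics.QuantumFieldTheory.Balaban1983to89.B8Eq142KLevelLocalRec

open Complex (I)
open MatrixLog B7Prop1Explicit B7Prop2Explicit B7Prop1Local B7AvgGaugeCovariance
open B7Eq92Concrete (mgauge mgauge_apply mgauge_mul)
open B7Prop3Flat (expCfg c3 insCfg)
open B7Prop5Flat (bondsIn restr mem_bondsIn insCfg_restr_of_mem agreeOn_insCfg_restr BondIn)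
open B7Prop2Rec (AvgClosedZ C0Z)
open B7Prop4GeneralLevelsRec (cZ gZ KZ)
open BlockAveragingZd (avgIterZ ctrShift)
open BlockAveragingZdCovariance (avgIterZ_gaugeAct_units)
open B7SectCDGaugeAveragesRec (wrecZ)
open B7SectEFLinearisationRec (logCovIterZ)
open B7Eq123GeneralRec (dbavgCovIterZ_eq_expCfg_logCovIterZ level_dataZ)
open B7LocalityRec (logCovIterZ_congr avgIterZ_congr inBox_nestZ pow_mul_half_add_ctrShift)
open B8Ineq130Rec (tlo thi tlo_apply thi_apply)
open B8Ineq132 (pdevOn_lt_of_forall)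
open B8Lemma1NonAbelianRecLoops (halfVec pairLo pairHi)
open B8Ineq172ConcreteRec (wrecZ_congr_tower)
open B8Eq137QjEqBRec (norm_Qj_lt_interior_regular norm_Qj_lt_crossing_regular norm_Qj_lt_crossing_mirrored)

-- `Site` alone could resolve to the torus sites of `Setup.lean`; re-export the `ℤ^d` sites of `B7Prop1Explicit`.
export B7Prop1Explicit (Site)

variable {d : ℕ}

/-! ## §1 Geometry, CENTRED: the two block towers under an `Lʲ`-bond sit in the box `Bʲ(c₋) ∪ Bʲ(c₊) = [Lʲy − c_j𝟙, Lʲy + Lʲe_κ + c_j𝟙]` -/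

section Geometry

/-- The centred box `Bʲ(c₋) ∪ Bʲ(c₊)` is a genuine box. [folklore] [cite: Balaban1987RG1, (0.3) p.252] -/
theorem lo_le_hi (L j : ℕ) (y : Site d) (κ : Fin d) :
    ∀ i, (fun i => (L : ℤ) ^ j * y i - (ctrShift L j : ℤ)) i ≤ (fun i => (L : ℤ) ^ j * y i + (ctrShift L j : ℤ) + if i = κ then (L : ℤ) ^ j else 0) i := fun i => by
  have hP : (0 : ℤ) ≤ (L : ℤ) ^ j := by positivity
  have hc : (0 : ℤ) ≤ (ctrShift L j : ℤ) := by positivity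
  dsimp only
  split_ifs <;> linarith

/-- The CENTRED block tower `[tlo y j, thi y j] = Bʲ(c₋)` under `c₋ = y` lies in the box `Bʲ(c₋) ∪ Bʲ(c₊)` (odd `L`). [cite: Balaban1985Averaging, p.24 (locality of (43)); Balaban1987RG1, (0.3) p.252] -/
theorem inBox_box_of_tower_fst {L : ℕ} (hL : Odd L) (j : ℕ) (y : Site d) (κ : Fin d) {x : Site d}
    (hx : InBox (tlo L y j) (thi L y j) x) :
    InBox (fun i => (L : ℤ) ^ j * y i - (ctrShift L j : ℤ)) (fun i => (L : ℤ) ^ j * y i + (ctrShift L j : ℤ) + if i = κ then (L : ℤ) ^ j else 0) x :=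
  fun i => by
  have h1 := (hx i).1
  have h2 := (hx i).2
  rw [tlo_apply hL] at h1
  rw [thi_apply hL] at h2
  have hP : (0 : ℤ) ≤ (L : ℤ) ^ j := by positivity
  dsimp only
  constructor
  · exact h1
  · split_ifs <;> linarith

/-- The CENTRED block tower `Bʲ(c₊)` under `c₊ = y + e_κ` lies in the box `Bʲ(c₋) ∪ Bʲ(c₊)` (odd `L`). [cite: Balaban1985Averaging, p.24 (locality of (43)); Balaban1987RG1, (0.3) p.252] -/
theorem inBox_box_of_tower_snd {L : ℕ} (hL : Odd L) (j : ℕ) (y : Site d) (κ : Fin d) {x : Site d}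
    (hx : InBox (tlo L (y + e κ) j) (thi L (y + e κ) j) x) :
    InBox (fun i => (L : ℤ) ^ j * y i - (ctrShift L j : ℤ)) (fun i => (L : ℤ) ^ j * y i + (ctrShift L j : ℤ) + if i = κ then (L : ℤ) ^ j else 0) x :=
  fun i => by
  have h1 := (hx i).1
  have h2 := (hx i).2
  rw [tlo_apply hL, add_e_apply] at h1
  rw [thi_apply hL, add_e_apply] at h2
  have hP : (0 : ℤ) ≤ (L : ℤ) ^ j := by positivity
  dsimp only
  constructor
  · split_ifs at h1 <;> nlinarith
  · split_ifs at h2 ⊢ <;> nlinarith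

variable {G : Type*}

/-- Agreement on a box restricts to agreement on any sub-box. [folklore] -/
private theorem agreeOn_of_subbox {lo hi LO HI : Site d} {V V' : Site d → Fin d → G}
    (hsub : ∀ x, InBox lo hi x → InBox LO HI x) (h : AgreeOn LO HI V V') : AgreeOn lo hi V V' :=
  fun x κ hx hxe => h x κ (hsub x hx) (hsub _ hxe)

/-- **`Bʲ(x) ⊆ B^{j+1}(y)` for a site `x` of the CENTRED block `B(y) = [L•y − s𝟙, L•y + s𝟙]`** (centred towers; `Lʲs + c_j = c_{j+1}`).
[cite: Balaban1985RegularSpaces, p.79 («x_n ∈ B(x_{n+1})»); Balaban1987RG1, (0.3) p.252] -/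
theorem tower_sub_of_block {L s : ℕ} (hLs : L = 2 * s + 1) (j : ℕ) {y x : Site d} (h1 : (L : ℤ) • y - halfVec L ≤ x) (h2 : x ≤ (L : ℤ) • y + halfVec L)
    {w : Site d} (hw : InBox (tlo L x j) (thi L x j) w) : InBox (tlo L y (j + 1)) (thi L y (j + 1)) w := fun i => by
  have hL : Odd L := ⟨s, by omega⟩
  have hs : ((L - 1) / 2 : ℕ) = s := by omega
  have hc : ((L : ℤ) ^ j) * (s : ℤ) + (ctrShift L j : ℤ) = (ctrShift L (j + 1) : ℤ) := by exact_mod_cast pow_mul_half_add_ctrShift hLs j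
  have hP : (0 : ℤ) ≤ (L : ℤ) ^ j := by positivity
  have a := h1 i
  have b := h2 i
  simp only [Pi.sub_apply, Pi.add_apply, Pi.smul_apply, smul_eq_mul, halfVec, hs] at a b
  have hw1 := (hw i).1
  have hw2 := (hw i).2
  rw [tlo_apply hL] at hw1 ⊢
  rw [thi_apply hL] at hw2 ⊢
  have ha := mul_le_mul_of_nonneg_left a hP
  have hb := mul_le_mul_of_nonneg_left b hP
  rw [pow_succ]
  constructor <;> nlinarith

/-- A site of the CENTRED block `[L•y − s𝟙, L•y + s𝟙]` lies in the pair box `[L•y − s𝟙, L•y + Le_κ + s𝟙]` (plumbing for `inBox_nestZ`). [folklore] [cite: Balaban1987RG1, (0.3) p.252] -/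
private theorem inBox_pair_of_block {L : ℕ} (y : Site d) (κ : Fin d) {x : Site d} (h1 : (L : ℤ) • y - halfVec L ≤ x) (h2 : x ≤ (L : ℤ) • y + halfVec L) :
    InBox (pairLo L ((L : ℤ) • y)) (pairHi L ((L : ℤ) • y) κ) x := fun i => by
  have a := h1 i
  have b := h2 i
  have hL0 : (0 : ℤ) ≤ (L : ℤ) := by positivity
  have hk0 : (0 : ℤ) ≤ ((L : ℤ) • e κ) i := by
    simp only [Pi.smul_apply, smul_eq_mul]
    exact mul_nonneg hL0 (by rw [e_apply]; split_ifs <;> norm_num)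
  simp only [pairLo, pairHi, Pi.sub_apply, Pi.add_apply] at a b ⊢
  exact ⟨a, by linarith⟩

/-- A site of the CENTRED block `[L•(y + e_κ) − s𝟙, L•(y + e_κ) + s𝟙]` lies in the pair box `[L•y − s𝟙, L•y + Le_κ + s𝟙]` (plumbing). [folklore] [cite: Balaban1987RG1, (0.3) p.252] -/
private theorem inBox_pair_of_block_snd {L : ℕ} (y : Site d) (κ : Fin d) {x : Site d} (h1 : (L : ℤ) • (y + e κ) - halfVec L ≤ x)
    (h2 : x ≤ (L : ℤ) • (y + e κ) + halfVec L) : InBox (pairLo L ((L : ℤ) • y)) (pairHi L ((L : ℤ) • y) κ) x := fun i => by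
  have a := h1 i
  have b := h2 i
  have hL0 : (0 : ℤ) ≤ (L : ℤ) := by positivity
  have hk0 : (0 : ℤ) ≤ ((L : ℤ) • e κ) i := by
    simp only [Pi.smul_apply, smul_eq_mul]
    exact mul_nonneg hL0 (by rw [e_apply]; split_ifs <;> norm_num)
  simp only [pairLo, pairHi, Pi.sub_apply, Pi.add_apply, smul_add] at a b ⊢
  exact ⟨by linarith, by linarith⟩

/-- **The level-`j` locality box of a bond `⟨z, z + e_μ⟩` of the CENTRED `L`-block `B(c₋)` lies in the level-`(j+1)` box `B^{j+1}(c₋) ∪ B^{j+1}(c₊)` of `c = ⟨y, y + e_κ⟩`**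
(`B7LocalityRec.inBox_nestZ`). [cite: Balaban1985Averaging, p.24 (locality of (43)); Balaban1987RG1, (0.3) p.252] -/
theorem inBox_box_of_blockBond {L s : ℕ} (hLs : L = 2 * s + 1) (j : ℕ) (y : Site d) (κ : Fin d) {z : Site d} {μ : Fin d}
    (h1 : (L : ℤ) • y - halfVec L ≤ z) (h2 : z + e μ ≤ (L : ℤ) • y + halfVec L) {w : Site d}
    (hw : InBox (fun i => (L : ℤ) ^ j * z i - (ctrShift L j : ℤ)) (fun i => (L : ℤ) ^ j * z i + (ctrShift L j : ℤ) + if i = μ then (L : ℤ) ^ j else 0) w) :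
    InBox (fun i => (L : ℤ) ^ (j + 1) * y i - (ctrShift L (j + 1) : ℤ))
      (fun i => (L : ℤ) ^ (j + 1) * y i + (ctrShift L (j + 1) : ℤ) + if i = κ then (L : ℤ) ^ (j + 1) else 0) w := by
  have hz : z ≤ (L : ℤ) • y + halfVec L := fun i => by
    have := h2 i; rw [add_e_apply] at this
    have h0 : (0 : ℤ) ≤ if i = μ then 1 else 0 := by split_ifs <;> norm_num
    linarith
  have hze : (L : ℤ) • y - halfVec L ≤ z + e μ := fun i => by
    have := h1 i; rw [add_e_apply]
    have h0 : (0 : ℤ) ≤ if i = μ then 1 else 0 := by split_ifs <;> norm_num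
    linarith
  exact inBox_nestZ hLs j y κ (inBox_pair_of_block y κ h1 hz) (inBox_pair_of_block y κ hze h2) hw

/-- The same for a bond of the CENTRED `L`-block `B(c₊)` under the UPPER end-point `c₊ = y + e_κ` (mirrored orientation). [cite: Balaban1985Averaging, p.24 (locality of (43)); Balaban1987RG1, (0.3) p.252] -/
theorem inBox_box_of_blockBond_snd {L s : ℕ} (hLs : L = 2 * s + 1) (j : ℕ) (y : Site d) (κ : Fin d) {z : Site d} {μ : Fin d}
    (h1 : (L : ℤ) • (y + e κ) - halfVec L ≤ z) (h2 : z + e μ ≤ (L : ℤ) • (y + e κ) + halfVec L) {w : Site d}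
    (hw : InBox (fun i => (L : ℤ) ^ j * z i - (ctrShift L j : ℤ)) (fun i => (L : ℤ) ^ j * z i + (ctrShift L j : ℤ) + if i = μ then (L : ℤ) ^ j else 0) w) :
    InBox (fun i => (L : ℤ) ^ (j + 1) * y i - (ctrShift L (j + 1) : ℤ))
      (fun i => (L : ℤ) ^ (j + 1) * y i + (ctrShift L (j + 1) : ℤ) + if i = κ then (L : ℤ) ^ (j + 1) else 0) w := by
  have hz : z ≤ (L : ℤ) • (y + e κ) + halfVec L := fun i => by
    have := h2 i; rw [add_e_apply] at this
    have h0 : (0 : ℤ) ≤ if i = μ then 1 else 0 := by split_ifs <;> norm_num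
    linarith
  have hze : (L : ℤ) • (y + e κ) - halfVec L ≤ z + e μ := fun i => by
    have := h1 i; rw [add_e_apply]
    have h0 : (0 : ℤ) ≤ if i = μ then 1 else 0 := by split_ifs <;> norm_num
    linarith
  exact inBox_nestZ hLs j y κ (inBox_pair_of_block_snd y κ h1 hz) (inBox_pair_of_block_snd y κ hze h2) hw

end Geometry

/-! ## §2 The (1.42) clause at ONE interior constraint bond from BOX DATA (tower-local form of `B8Eq137QjEqBRec` §5), record averaging -/

section Interior

variable {𝔸 : Type*} [NormedRing 𝔸] [NormOneClass 𝔸] [NormedAlgebra ℂ 𝔸] [CompleteSpace 𝔸]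

omit [NormOneClass 𝔸] [NormedAlgebra ℂ 𝔸] [CompleteSpace 𝔸] in
/-- The restriction `B|_{box}` is bounded by a common bound of `B` on the box's bonds (private plumbing). [folklore] -/
private theorem norm_insCfg_restr_le' {lo hi : Site d} {B : Site d → Fin d → 𝔸} {b : ℝ}
    (hB : ∀ x μ, BondIn lo hi x μ → ‖B x μ‖ ≤ b) (hb : 0 ≤ b) :
    ∀ x μ, ‖insCfg (bondsIn lo hi) (restr (bondsIn lo hi) B) x μ‖ ≤ b := fun x μ => by
  by_cases h : (x, μ) ∈ bondsIn lo hi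
  · rw [insCfg_restr_of_mem _ _ h]; exact hB x μ (mem_bondsIn.mp h)
  · simp only [insCfg, h, dite_false, norm_zero]; exact hb

/-- (RECORD TWIN of `B8Eq142KLevelLocal.norm_Qj_lt_interior_loc`.) **THE (1.42) CLAUSE «|Q_j(U₀, ηA)(c)| < 2dLα₁» AT ONE INTERIOR CONSTRAINT BOND FROM BOX DATA, RECORD
AVERAGING**: at a bond `c = ⟨y, y + e_κ⟩` of the `(j+1)`-lattice, if inside the CENTRED box `B^{j+1}(c₋) ∪ B^{j+1}(c₊)` the (`G`-valued, `G` record-averaging-closed)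
background `U₀` has plaquettes obeying (1.40) at level `j + 1`, the exponent field `B` (`U₁ = e^{B}` on the box's bonds) obeys `‖B_b‖ ≤ b` with `L^{j+1}b` in the record's
Prop-4 window, the gauge transformation `u` satisfies (87) at `c₋` and `c₊` for `(U₀, U₁)`, and (1.35) holds at `c` for `U′U₀ = (U₁^{u})U₀`, THEN `‖Q_{j+1}(U₀, B)(c)‖ < 2dLα₁`.
PROOF: clamp `U₀` and restrict `B` to the box, apply the GLOBAL record lemma at `k := j + 1`, transport back by `B7LocalityRec.logCovIterZ_congr`,
`B8Ineq172ConcreteRec.wrecZ_congr_tower`, `B7LocalityRec.avgIterZ_congr`. [cite: Balaban1985RegularSpaces, (1.42) p.83, (1.37) p.82, (1.35) p.82; Balaban1985Averaging, p.24 (locality), (87) p.31; Balaban1987RG1, (0.3)–(0.4) pp.252–253] -/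
theorem norm_Qj_lt_interior_loc {L s : ℕ} (hLs : L = 2 * s + 1) (hs : 1 ≤ s) (hd : 1 ≤ d) {G : Subgroup 𝔸ˣ} (hG : AvgClosedZ d L G)
    (j : ℕ) (U₀ : Site d → Fin d → 𝔸ˣ) (y : Site d) (κ : Fin d)
    (hU₀ : ∀ x μ, U₀ x μ ∈ G)
    {α₀ : ℝ} (hα₀ : 0 < α₀) (hα3 : C0Z d * α₀ ≤ 1 / 3) (hα4 : 4 * α₀ ≤ c2' d L)
    (h40 : ∀ (x : Site d) (μ ν : Fin d), μ ≠ ν →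
      PlaqIn (fun i => (L : ℤ) ^ (j + 1) * y i - (ctrShift L (j + 1) : ℤ))
        (fun i => (L : ℤ) ^ (j + 1) * y i + (ctrShift L (j + 1) : ℤ) + if i = κ then (L : ℤ) ^ (j + 1) else 0) (x, μ, ν) →
      ‖((hol U₀ x (plaqWord μ ν) : 𝔸ˣ) : 𝔸) - 1‖ < α₀ * (((L : ℝ) ^ (j + 1))⁻¹) ^ 2)
    (B : Site d → Fin d → 𝔸) {b : ℝ} (hb : 0 ≤ b)
    (hB : ∀ x μ, BondIn (fun i => (L : ℤ) ^ (j + 1) * y i - (ctrShift L (j + 1) : ℤ))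
      (fun i => (L : ℤ) ^ (j + 1) * y i + (ctrShift L (j + 1) : ℤ) + if i = κ then (L : ℤ) ^ (j + 1) else 0) x μ → ‖B x μ‖ ≤ b)
    (hsm : Real.exp (4 * cZ d * α₀) * (1 + 2 * (131072 * ((d : ℝ) + 1) ^ 2) * (KZ d L) ^ 2 * ((L : ℝ) ^ (j + 1) * b)) ≤ 2)
    (hc₃ : KZ d L * ((L : ℝ) ^ (j + 1) * b) ≤ c3 d L)
    (u : Site d → 𝔸ˣ) (U₁ : Site d → Fin d → 𝔸ˣ)
    (hU₁ : AgreeOn (fun i => (L : ℤ) ^ (j + 1) * y i - (ctrShift L (j + 1) : ℤ))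
      (fun i => (L : ℤ) ^ (j + 1) * y i + (ctrShift L (j + 1) : ℤ) + if i = κ then (L : ℤ) ^ (j + 1) else 0) U₁ (expCfg B))
    (hm : uLev L u (j + 1) y = (wrecZ L U₀ U₁ (j + 1) y)⁻¹)
    (hp : uLev L u (j + 1) (y + e κ) = (wrecZ L U₀ U₁ (j + 1) (y + e κ))⁻¹)
    {α₁ : ℝ} (hα : 0 < α₁) (hsmall : (d : ℝ) * L * α₁ ≤ 1 / 8)
    (h135 : ‖(avgIterZ L (mgauge U₀ u U₁ * U₀) (j + 1) y κ : 𝔸) - (avgIterZ L U₀ (j + 1) y κ : 𝔸)‖ ≤ α₁) :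
    ‖logCovIterZ L U₀ B (j + 1) y κ‖ < 2 * d * L * α₁ := by
  have hL : Odd L := ⟨s, by omega⟩
  have hLr : (0 : ℝ) < (L : ℝ) := by exact_mod_cast (show 0 < L by omega)
  have hpos : 0 < α₀ * (((L : ℝ) ^ (j + 1))⁻¹) ^ 2 := mul_pos hα₀ (pow_pos (inv_pos.mpr (pow_pos hLr (j + 1))) 2)
  set lo : Site d := fun i => (L : ℤ) ^ (j + 1) * y i - (ctrShift L (j + 1) : ℤ) with hlo
  set hi : Site d := fun i => (L : ℤ) ^ (j + 1) * y i + (ctrShift L (j + 1) : ℤ) + if i = κ then (L : ℤ) ^ (j + 1) else 0 with hhi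
  have hlohi : ∀ i, lo i ≤ hi i := lo_le_hi L (j + 1) y κ
  -- the clamped background and its global data
  set U₀' := clampCfg lo hi U₀ with hU₀'_def
  have hU₀1 : ∀ x μ, U₀ x μ ∈ U1 𝔸 := fun x μ => hG.le_U1 (hU₀ x μ)
  have hU₀'G : ∀ x μ, U₀' x μ ∈ G := clampCfg_mem hU₀
  have hpdOn : pdevOn lo hi U₀ < α₀ * (((L : ℝ) ^ (j + 1))⁻¹) ^ 2 := by
    refine pdevOn_lt_of_forall hpos fun x μ ν hx hx' => ?_
    rcases eq_or_ne μ ν with rfl | hμν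
    · rw [hol_plaqWord_self, Units.val_one, sub_self, norm_zero]; exact hpos
    · exact h40 x μ ν hμν ⟨hx, hx'⟩
  have hpdev : pdev U₀' < α₀ * (((L : ℝ) ^ (j + 1))⁻¹) ^ 2 := (pdev_clampCfg_le hlohi hU₀1).trans_lt hpdOn
  -- the restricted exponent field and its global bound
  set B' := insCfg (bondsIn lo hi) (restr (bondsIn lo hi) B) with hB'_def
  have hB' : ∀ x μ, ‖B' x μ‖ ≤ b := norm_insCfg_restr_le' hB hb
  -- agreements on the box
  have hagU : AgreeOn lo hi U₀' U₀ := clampCfg_agree U₀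
  have hagB : AgreeOn lo hi B B' := agreeOn_insCfg_restr lo hi B
  have hagE : AgreeOn lo hi U₁ (expCfg B') := fun x μ hx hxe => by
    rw [hU₁ x μ hx hxe]
    apply Units.ext
    show exp (B x μ) = exp (B' x μ)
    rw [hagB x μ hx hxe]
  -- (87) at `c₋`, `c₊` for the clamped pair: the record block frames (85) are tower-local
  have hw : ∀ z : Site d, (∀ x, InBox (tlo L z (j + 1)) (thi L z (j + 1)) x → InBox lo hi x) →
      wrecZ L U₀ U₁ (j + 1) z = wrecZ L U₀' (expCfg B') (j + 1) z := by
    intro z hsub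
    exact wrecZ_congr_tower hLs (agreeOn_of_subbox hsub hagU).symm (agreeOn_of_subbox hsub hagE) (j + 1) 0 (by omega) z
      (by rw [B8Ineq130Rec.tlo_zero]) (by rw [B8Ineq130Rec.thi_zero])
  have hm' : uLev L u (j + 1) y = (wrecZ L U₀' (expCfg B') (j + 1) y)⁻¹ := by
    rw [hm, hw y fun x hx => inBox_box_of_tower_fst hL (j + 1) y κ hx]
  have hp' : uLev L u (j + 1) (y + e κ) = (wrecZ L U₀' (expCfg B') (j + 1) (y + e κ))⁻¹ := by
    rw [hp, hw (y + e κ) fun x hx => inBox_box_of_tower_snd hL (j + 1) y κ hx]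
  -- (1.35) at `c` for the clamped pair: the `(j+1)`-fold record averages are box-local
  have hav₁ : avgIterZ L (mgauge U₀' u (expCfg B') * U₀') (j + 1) y κ = avgIterZ L (mgauge U₀ u U₁ * U₀) (j + 1) y κ := by
    refine avgIterZ_congr hLs (j + 1) y κ fun x μ hx hxe => ?_
    show mgauge U₀' u (expCfg B') x μ * U₀' x μ = mgauge U₀ u U₁ x μ * U₀ x μ
    rw [mgauge_apply, mgauge_apply, hagU x μ hx hxe, (hagE x μ hx hxe).symm]
  have hav₀ : avgIterZ L U₀' (j + 1) y κ = avgIterZ L U₀ (j + 1) y κ := avgIterZ_congr hLs (j + 1) y κ hagU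
  have h135' : ‖(avgIterZ L (mgauge U₀' u (expCfg B') * U₀') (j + 1) y κ : 𝔸) - (avgIterZ L U₀' (j + 1) y κ : 𝔸)‖ ≤ α₁ := by
    rw [hav₁, hav₀]; exact h135
  -- the global record lemma for the clamped pair at `k := j + 1`, transported back
  have key := norm_Qj_lt_interior_regular hLs hs hd hG (j + 1) U₀' hU₀'G hα₀ hα3 hα4 hpdev B' hb hB' hsm hc₃ u le_rfl y κ
    hm' hp' hα hsmall h135'
  rwa [logCovIterZ_congr hLs (j + 1) y κ hagU hagB.symm] at key

end Interior

/-! ## §3 The (1.42) clause at ONE CROSSING constraint bond from BOX DATA (tower-local forms of `B8Eq137QjEqBRec.norm_Qj_lt_crossing_regular` ∕ `_mirrored`), record averaging -/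

section Crossing

variable {G : Type*} [Group G] {lo hi : Site d}

/-- `π^*(VW) = π^*V · π^*W` (the clamp acts bondwise; private copy of the lineage's lemma). [folklore] -/
private theorem clampCfg_mul' (V W : Site d → Fin d → G) : clampCfg lo hi (V * W) = clampCfg lo hi V * clampCfg lo hi W := by
  funext x κ
  simp only [clampCfg, Pi.mul_apply]
  split_ifs <;> simp

variable {𝔸 : Type*} [NormedRing 𝔸] [NormOneClass 𝔸] [NormedAlgebra ℂ 𝔸] [CompleteSpace 𝔸]

omit [NormOneClass 𝔸] in
/-- `π^*(e^{B}) = e^{B^π}` for the clamped exponent (private copy of the lineage's lemma). [folklore] -/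
private theorem clampCfg_expCfg' (lo hi : Site d) (B : Site d → Fin d → 𝔸) :
    clampCfg lo hi (expCfg B) = expCfg (fun x κ => if lo κ ≤ x κ ∧ x κ < hi κ then B (clamp lo hi x) κ else 0) := by
  funext x κ
  simp only [clampCfg, expCfg]
  split_ifs
  · rfl
  · exact (B7Prop8Flat.expUnit_zero (𝔸 := 𝔸)).symm

omit [NormOneClass 𝔸] [NormedAlgebra ℂ 𝔸] [CompleteSpace 𝔸] in
/-- The clamped exponent inherits the box bound on the box's bonds (private copy of the lineage's lemma). [folklore] -/
private theorem norm_clampB_le' {lo hi : Site d} (hlohi : ∀ i, lo i ≤ hi i) {B : Site d → Fin d → 𝔸} {b : ℝ} (hb : 0 ≤ b)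
    (hB : ∀ x μ, BondIn lo hi x μ → ‖B x μ‖ ≤ b) (x : Site d) (κ : Fin d) :
    ‖(fun x κ => if lo κ ≤ x κ ∧ x κ < hi κ then B (clamp lo hi x) κ else 0) x κ‖ ≤ b := by
  by_cases hP : lo κ ≤ x κ ∧ x κ < hi κ
  · simp only [hP, and_self, if_true]
    have hx := clamp_inBox hlohi x
    have hxe : InBox lo hi (clamp lo hi x + e κ) := by rw [← clamp_add_e_of hP]; exact clamp_inBox hlohi _
    exact hB _ κ ⟨hx, hxe⟩
  · simp only [hP, if_false, norm_zero]
    exact hb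

/-- (RECORD TWIN of `B8Eq142KLevelLocal.norm_Qj_lt_crossing_loc`.) **THE (1.42) CLAUSE AT ONE CROSSING CONSTRAINT BOND FROM BOX DATA, RECORD AVERAGING**: at a bond
`c = ⟨y, y + e_κ⟩` of the `(j+1)`-lattice whose LOWER end-point's CENTRED `L`-block `B(c₋) = [L•y − s𝟙, L•y + s𝟙]` consists of constraint sites of level `j` ((87) at level
`j` on the block, `h87`) and whose upper end-point is a constraint site of level `j + 1` ((87) at `c₊`, `hp`), if inside the centred box `B^{j+1}(c₋) ∪ B^{j+1}(c₊)` the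
`G`-valued background `U₀` AND the field `U₁U₀` (`U₁ = e^{B}` on the box, `e^{B}` `G`-valued) have plaquettes obeying (1.40) at level `j + 1`, `‖B‖ ≤ b` on the box's bonds with
`L^{j+1}b` in the record's Prop-4 window, and (1.35) holds on the level-`j` bonds of `B(c₋)` and at `c` for `U′U₀ = U₁^{u}U₀`, `u` with values in `{|u|, |u⁻¹| ≤ 1}`, THEN
`‖Q_{j+1}(U₀, B)(c)‖ < 2dLα₁`.  The `U1`-membership of the record averages of `U′U₀ = (e^{B}U₀)^{u}` is DERIVED for the clamped data from the record Prop. 2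
(`B7Eq123GeneralRec.level_dataZ`) and the UNCONDITIONAL gauge covariance (11) of the (0.4) average (`BlockAveragingZdCovariance.avgIterZ_gaugeAct_units`).
[cite: Balaban1985RegularSpaces, (1.42) p.83, (1.37) + (1.31) p.82, (1.35) p.82; Balaban1985Averaging, p.24, (11) p.19, (87) p.31; Balaban1987RG1, (0.3)–(0.4) pp.252–253, (0.6) p.253] -/
theorem norm_Qj_lt_crossing_loc {L s : ℕ} (hLs : L = 2 * s + 1) (hs : 1 ≤ s) (hd : 1 ≤ d) {G : Subgroup 𝔸ˣ} (hG : AvgClosedZ d L G)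
    (j : ℕ) (U₀ : Site d → Fin d → 𝔸ˣ) (y : Site d) (κ : Fin d)
    (hU₀ : ∀ x μ, U₀ x μ ∈ G)
    {α₀ : ℝ} (hα₀ : 0 < α₀) (hα3 : C0Z d * α₀ ≤ 1 / 3) (hα4 : 4 * α₀ ≤ c2' d L)
    (h40 : ∀ (x : Site d) (μ ν : Fin d), μ ≠ ν →
      PlaqIn (fun i => (L : ℤ) ^ (j + 1) * y i - (ctrShift L (j + 1) : ℤ))
        (fun i => (L : ℤ) ^ (j + 1) * y i + (ctrShift L (j + 1) : ℤ) + if i = κ then (L : ℤ) ^ (j + 1) else 0) (x, μ, ν) →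
      ‖((hol U₀ x (plaqWord μ ν) : 𝔸ˣ) : 𝔸) - 1‖ < α₀ * (((L : ℝ) ^ (j + 1))⁻¹) ^ 2)
    (B : Site d → Fin d → 𝔸) (hBG : ∀ x μ, expCfg B x μ ∈ G) {b : ℝ} (hb : 0 ≤ b)
    (hB : ∀ x μ, BondIn (fun i => (L : ℤ) ^ (j + 1) * y i - (ctrShift L (j + 1) : ℤ))
      (fun i => (L : ℤ) ^ (j + 1) * y i + (ctrShift L (j + 1) : ℤ) + if i = κ then (L : ℤ) ^ (j + 1) else 0) x μ → ‖B x μ‖ ≤ b)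
    (hsm : Real.exp (4 * cZ d * α₀) * (1 + 2 * (131072 * ((d : ℝ) + 1) ^ 2) * (KZ d L) ^ 2 * ((L : ℝ) ^ (j + 1) * b)) ≤ 2)
    (hc₃ : KZ d L * ((L : ℝ) ^ (j + 1) * b) ≤ c3 d L)
    (u : Site d → 𝔸ˣ) (hu : ∀ x, u x ∈ U1 𝔸) (U₁ : Site d → Fin d → 𝔸ˣ)
    (hU₁ : AgreeOn (fun i => (L : ℤ) ^ (j + 1) * y i - (ctrShift L (j + 1) : ℤ))
      (fun i => (L : ℤ) ^ (j + 1) * y i + (ctrShift L (j + 1) : ℤ) + if i = κ then (L : ℤ) ^ (j + 1) else 0) U₁ (expCfg B))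
    (h40' : ∀ (x : Site d) (μ ν : Fin d), μ ≠ ν →
      PlaqIn (fun i => (L : ℤ) ^ (j + 1) * y i - (ctrShift L (j + 1) : ℤ))
        (fun i => (L : ℤ) ^ (j + 1) * y i + (ctrShift L (j + 1) : ℤ) + if i = κ then (L : ℤ) ^ (j + 1) else 0) (x, μ, ν) →
      ‖((hol (U₁ * U₀) x (plaqWord μ ν) : 𝔸ˣ) : 𝔸) - 1‖ < α₀ * (((L : ℝ) ^ (j + 1))⁻¹) ^ 2)
    (h87 : ∀ x : Site d, (L : ℤ) • y - halfVec L ≤ x → x ≤ (L : ℤ) • y + halfVec L → uLev L u j x = (wrecZ L U₀ U₁ j x)⁻¹)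
    (hp : uLev L u (j + 1) (y + e κ) = (wrecZ L U₀ U₁ (j + 1) (y + e κ))⁻¹)
    {α₁ : ℝ} (hα : 0 < α₁) (hsmall : (d : ℝ) * L * α₁ ≤ 1 / 8)
    (h135 : ∀ (z : Site d) (μ : Fin d), (L : ℤ) • y - halfVec L ≤ z → z + e μ ≤ (L : ℤ) • y + halfVec L →
      ‖(avgIterZ L (mgauge U₀ u U₁ * U₀) j z μ : 𝔸) - (avgIterZ L U₀ j z μ : 𝔸)‖ ≤ α₁)
    (h135b : ‖(avgIterZ L (mgauge U₀ u U₁ * U₀) (j + 1) y κ : 𝔸) - (avgIterZ L U₀ (j + 1) y κ : 𝔸)‖ ≤ α₁) :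
    ‖logCovIterZ L U₀ B (j + 1) y κ‖ < 2 * d * L * α₁ := by
  have hL : Odd L := ⟨s, by omega⟩
  have hL2 : 2 ≤ L := by omega
  have hLr : (0 : ℝ) < (L : ℝ) := by exact_mod_cast (show 0 < L by omega)
  have hpos : 0 < α₀ * (((L : ℝ) ^ (j + 1))⁻¹) ^ 2 := mul_pos hα₀ (pow_pos (inv_pos.mpr (pow_pos hLr (j + 1))) 2)
  set lo : Site d := fun i => (L : ℤ) ^ (j + 1) * y i - (ctrShift L (j + 1) : ℤ) with hlo
  set hi : Site d := fun i => (L : ℤ) ^ (j + 1) * y i + (ctrShift L (j + 1) : ℤ) + if i = κ then (L : ℤ) ^ (j + 1) else 0 with hhi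
  have hlohi : ∀ i, lo i ≤ hi i := lo_le_hi L (j + 1) y κ
  have hU₀1 : ∀ x μ, U₀ x μ ∈ U1 𝔸 := fun x μ => hG.le_U1 (hU₀ x μ)
  -- the clamped background
  set U₀' := clampCfg lo hi U₀ with hU₀'_def
  have hU₀'G : ∀ x μ, U₀' x μ ∈ G := clampCfg_mem hU₀
  have hpdOn : pdevOn lo hi U₀ < α₀ * (((L : ℝ) ^ (j + 1))⁻¹) ^ 2 := by
    refine pdevOn_lt_of_forall hpos fun x μ ν hx hx' => ?_
    rcases eq_or_ne μ ν with rfl | hμν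
    · rw [hol_plaqWord_self, Units.val_one, sub_self, norm_zero]; exact hpos
    · exact h40 x μ ν hμν ⟨hx, hx'⟩
  have hpdev : pdev U₀' < α₀ * (((L : ℝ) ^ (j + 1))⁻¹) ^ 2 := (pdev_clampCfg_le hlohi hU₀1).trans_lt hpdOn
  -- the clamped exponent
  set Bc : Site d → Fin d → 𝔸 := fun x μ => if lo μ ≤ x μ ∧ x μ < hi μ then B (clamp lo hi x) μ else 0 with hBc_def
  have hexp : clampCfg lo hi (expCfg B) = expCfg Bc := clampCfg_expCfg' lo hi B
  have hBc : ∀ x μ, ‖Bc x μ‖ ≤ b := norm_clampB_le' hlohi hb hB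
  have hBcG : ∀ x μ, expCfg Bc x μ ∈ G := fun x μ => by rw [← hexp]; exact clampCfg_mem hBG x μ
  -- agreements on the box
  have hagU : AgreeOn lo hi U₀' U₀ := clampCfg_agree U₀
  have hagEc : AgreeOn lo hi (expCfg Bc) (expCfg B) := by rw [← hexp]; exact clampCfg_agree (expCfg B)
  have hagE : AgreeOn lo hi U₁ (expCfg Bc) := fun x μ hx hxe => by rw [hU₁ x μ hx hxe, hagEc x μ hx hxe]
  have hagB : AgreeOn lo hi B Bc := fun x μ hx hxe => by
    have hr : lo μ ≤ x μ ∧ x μ < hi μ := ⟨(hx μ).1, by have := (hxe μ).2; rw [add_e_apply, if_pos rfl] at this; omega⟩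
    simp only [hBc_def, hr, and_self, if_true, clamp_of_inBox hx]
  -- the clamped product `e^{Bc}·π^*U₀ = π^*(U₁U₀)` is `G`-valued with small plaquettes: the record Prop. 2 applies to it
  set V := expCfg Bc * U₀' with hV_def
  have hVG : ∀ x μ, V x μ ∈ G := fun x μ => by
    rw [hV_def, Pi.mul_apply]; exact G.mul_mem (hBcG x μ) (hU₀'G x μ)
  have hprod : V = clampCfg lo hi (expCfg B * U₀) := by rw [hV_def, clampCfg_mul', hexp]
  have hPU : ∀ x μ, (expCfg B * U₀) x μ ∈ U1 𝔸 := fun x μ => by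
    rw [Pi.mul_apply]; exact (U1 𝔸).mul_mem (hG.le_U1 (hBG x μ)) (hU₀1 x μ)
  have hagP : AgreeOn lo hi (expCfg B * U₀) (U₁ * U₀) := B7LocalityGeneral.agreeOn_mul (fun x μ hx hxe => (hU₁ x μ hx hxe).symm)
    (fun _ _ _ _ => rfl)
  have hpdP : pdevOn lo hi (expCfg B * U₀) < α₀ * (((L : ℝ) ^ (j + 1))⁻¹) ^ 2 := by
    refine pdevOn_lt_of_forall hpos fun x μ ν hx hx' => ?_
    rcases eq_or_ne μ ν with rfl | hμν
    · rw [hol_plaqWord_self, Units.val_one, sub_self, norm_zero]; exact hpos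
    · rw [B8Ineq130.hol_plaqWord_congr hagP x μ ν hx hx']
      exact h40' x μ ν hμν ⟨hx, hx'⟩
  have hPV : pdev V < α₀ * (((L : ℝ) ^ (j + 1))⁻¹) ^ 2 := by
    rw [hprod]; exact (pdev_clampCfg_le hlohi hPU).trans_lt hpdP
  -- `U1`-membership of the record averages of `(e^{Bc}U₀')^{u}` at the levels `≤ j + 1` (record Prop. 2 + the unconditional covariance (11) of (0.4))
  have hfield : mgauge U₀' u (expCfg Bc) * U₀' = gaugeAct u V := mgauge_mul U₀' u (expCfg Bc)
  have havU1 : ∀ j', j' ≤ j + 1 → ∀ x μ, avgIterZ L (mgauge U₀' u (expCfg Bc) * U₀') j' x μ ∈ U1 𝔸 := by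
    intro j' hj' x μ
    rw [hfield, avgIterZ_gaugeAct_units]
    have hX := (level_dataZ L hL2 hG (j + 1) V hVG hα₀ hα3 hα4 hPV j' hj').1 x μ
    show uLev L u j' x * avgIterZ L V j' x μ * (uLev L u j' (x + e μ))⁻¹ ∈ U1 𝔸
    exact (U1 𝔸).mul_mem ((U1 𝔸).mul_mem (uLev_mem hu L j' x) hX) ((U1 𝔸).inv_mem (uLev_mem hu L j' _))
  -- (87) for the clamped pair: on the block under `c₋` (level `j`) and at `c₊` (level `j + 1`)
  have h87' : ∀ x : Site d, InBox ((L : ℤ) • y - halfVec L) ((L : ℤ) • y + halfVec L) x → uLev L u j x = (wrecZ L U₀' (expCfg Bc) j x)⁻¹ := by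
    intro x hx
    have hx1 : (L : ℤ) • y - halfVec L ≤ x := fun i => (hx i).1
    have hx2 : x ≤ (L : ℤ) • y + halfVec L := fun i => (hx i).2
    have hsub : ∀ w, InBox (tlo L x j) (thi L x j) w → InBox lo hi w := fun w hw =>
      inBox_box_of_tower_fst hL (j + 1) y κ (tower_sub_of_block hLs j hx1 hx2 hw)
    rw [h87 x hx1 hx2, wrecZ_congr_tower hLs (agreeOn_of_subbox hsub hagU).symm (agreeOn_of_subbox hsub hagE) j 0 (by omega) x
      (by rw [B8Ineq130Rec.tlo_zero]) (by rw [B8Ineq130Rec.thi_zero])]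
  have hp' : uLev L u (j + 1) (y + e κ) = (wrecZ L U₀' (expCfg Bc) (j + 1) (y + e κ))⁻¹ := by
    have hsub : ∀ w, InBox (tlo L (y + e κ) (j + 1)) (thi L (y + e κ) (j + 1)) w → InBox lo hi w := fun w hw =>
      inBox_box_of_tower_snd hL (j + 1) y κ hw
    rw [hp, wrecZ_congr_tower hLs (agreeOn_of_subbox hsub hagU).symm (agreeOn_of_subbox hsub hagE) (j + 1) 0 (by omega) (y + e κ)
      (by rw [B8Ineq130Rec.tlo_zero]) (by rw [B8Ineq130Rec.thi_zero])]
  -- (1.35) for the clamped pair: on the level-`j` bonds of the block and at `c`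
  have hagF : AgreeOn lo hi (mgauge U₀' u (expCfg Bc) * U₀') (mgauge U₀ u U₁ * U₀) := fun x μ hx hxe => by
    show mgauge U₀' u (expCfg Bc) x μ * U₀' x μ = mgauge U₀ u U₁ x μ * U₀ x μ
    rw [mgauge_apply, mgauge_apply, hagU x μ hx hxe, (hagE x μ hx hxe).symm]
  have h135' : ∀ (z : Site d) (μ : Fin d), (L : ℤ) • y - halfVec L ≤ z → z + e μ ≤ (L : ℤ) • y + halfVec L →
      ‖(avgIterZ L (mgauge U₀' u (expCfg Bc) * U₀') j z μ : 𝔸) - (avgIterZ L U₀' j z μ : 𝔸)‖ ≤ α₁ := by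
    intro z μ hz1 hz2
    rw [avgIterZ_congr hLs j z μ (agreeOn_of_subbox (fun w hw => inBox_box_of_blockBond hLs j y κ hz1 hz2 hw) hagF),
      avgIterZ_congr hLs j z μ (agreeOn_of_subbox (fun w hw => inBox_box_of_blockBond hLs j y κ hz1 hz2 hw) hagU)]
    exact h135 z μ hz1 hz2
  have h135b' : ‖(avgIterZ L (mgauge U₀' u (expCfg Bc) * U₀') (j + 1) y κ : 𝔸) - (avgIterZ L U₀' (j + 1) y κ : 𝔸)‖ ≤ α₁ := by
    rw [avgIterZ_congr hLs (j + 1) y κ hagF, avgIterZ_congr hLs (j + 1) y κ hagU]; exact h135b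
  -- the global record lemma for the clamped data at `k := j + 1`, transported back
  have key := norm_Qj_lt_crossing_regular hLs hs hd hG (j + 1) U₀' hU₀'G hα₀ hα3 hα4 hpdev Bc hb hBc hsm hc₃ u le_rfl y κ
    (fun x hx => h87' x hx) hp' (havU1 j (Nat.le_succ j)) (havU1 (j + 1) le_rfl y κ) hα hsmall h135' h135b'
  rwa [logCovIterZ_congr hLs (j + 1) y κ hagU hagB.symm] at key

/-- (RECORD TWIN of `B8Eq142KLevelLocal.norm_Qj_lt_crossing_mirrored_loc`.) **THE (1.42) CLAUSE AT ONE MIRRORED CROSSING CONSTRAINT BOND FROM BOX DATA, RECORD AVERAGING**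
(`c₋` a constraint site of level `j + 1`, the CENTRED `L`-block `B(c₊)` made of constraint sites of level `j`): the tower-local form of `B8Eq137QjEqBRec.norm_Qj_lt_crossing_mirrored`
in the record's Prop-4 regime (the identification (127) `hId` and the `U1`-memberships discharged for the clamped data by `B7Eq123GeneralRec.dbavgCovIterZ_eq_expCfg_logCovIterZ` ∕
`level_dataZ` and the unconditional covariance (11)); hypotheses as in `norm_Qj_lt_crossing_loc` with the roles of `c₋`, `c₊` exchanged.
[cite: Balaban1985RegularSpaces, (1.42) p.83, (1.37) + (1.31) p.82, (1.35) p.82; Balaban1985Averaging, p.24, (11) p.19, (87) p.31, (127) p.37; Balaban1987RG1, (0.3)–(0.4) pp.252–253] -/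
theorem norm_Qj_lt_crossing_mirrored_loc {L s : ℕ} (hLs : L = 2 * s + 1) (hs : 1 ≤ s) (hd : 1 ≤ d) {G : Subgroup 𝔸ˣ} (hG : AvgClosedZ d L G)
    (j : ℕ) (U₀ : Site d → Fin d → 𝔸ˣ) (y : Site d) (κ : Fin d)
    (hU₀ : ∀ x μ, U₀ x μ ∈ G)
    {α₀ : ℝ} (hα₀ : 0 < α₀) (hα3 : C0Z d * α₀ ≤ 1 / 3) (hα4 : 4 * α₀ ≤ c2' d L)
    (h40 : ∀ (x : Site d) (μ ν : Fin d), μ ≠ ν →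
      PlaqIn (fun i => (L : ℤ) ^ (j + 1) * y i - (ctrShift L (j + 1) : ℤ))
        (fun i => (L : ℤ) ^ (j + 1) * y i + (ctrShift L (j + 1) : ℤ) + if i = κ then (L : ℤ) ^ (j + 1) else 0) (x, μ, ν) →
      ‖((hol U₀ x (plaqWord μ ν) : 𝔸ˣ) : 𝔸) - 1‖ < α₀ * (((L : ℝ) ^ (j + 1))⁻¹) ^ 2)
    (B : Site d → Fin d → 𝔸) (hBG : ∀ x μ, expCfg B x μ ∈ G) {b : ℝ} (hb : 0 ≤ b)
    (hB : ∀ x μ, BondIn (fun i => (L : ℤ) ^ (j + 1) * y i - (ctrShift L (j + 1) : ℤ))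
      (fun i => (L : ℤ) ^ (j + 1) * y i + (ctrShift L (j + 1) : ℤ) + if i = κ then (L : ℤ) ^ (j + 1) else 0) x μ → ‖B x μ‖ ≤ b)
    (hsm : Real.exp (4 * cZ d * α₀) * (1 + 2 * (131072 * ((d : ℝ) + 1) ^ 2) * (KZ d L) ^ 2 * ((L : ℝ) ^ (j + 1) * b)) ≤ 2)
    (hc₃ : KZ d L * ((L : ℝ) ^ (j + 1) * b) ≤ c3 d L)
    (u : Site d → 𝔸ˣ) (hu : ∀ x, u x ∈ U1 𝔸) (U₁ : Site d → Fin d → 𝔸ˣ)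
    (hU₁ : AgreeOn (fun i => (L : ℤ) ^ (j + 1) * y i - (ctrShift L (j + 1) : ℤ))
      (fun i => (L : ℤ) ^ (j + 1) * y i + (ctrShift L (j + 1) : ℤ) + if i = κ then (L : ℤ) ^ (j + 1) else 0) U₁ (expCfg B))
    (h40' : ∀ (x : Site d) (μ ν : Fin d), μ ≠ ν →
      PlaqIn (fun i => (L : ℤ) ^ (j + 1) * y i - (ctrShift L (j + 1) : ℤ))
        (fun i => (L : ℤ) ^ (j + 1) * y i + (ctrShift L (j + 1) : ℤ) + if i = κ then (L : ℤ) ^ (j + 1) else 0) (x, μ, ν) →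
      ‖((hol (U₁ * U₀) x (plaqWord μ ν) : 𝔸ˣ) : 𝔸) - 1‖ < α₀ * (((L : ℝ) ^ (j + 1))⁻¹) ^ 2)
    (hm : uLev L u (j + 1) y = (wrecZ L U₀ U₁ (j + 1) y)⁻¹)
    (h87 : ∀ x : Site d, (L : ℤ) • (y + e κ) - halfVec L ≤ x → x ≤ (L : ℤ) • (y + e κ) + halfVec L → uLev L u j x = (wrecZ L U₀ U₁ j x)⁻¹)
    {α₁ : ℝ} (hα : 0 < α₁) (hsmall : (d : ℝ) * L * α₁ ≤ 1 / 8)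
    (h135 : ∀ (z : Site d) (μ : Fin d), (L : ℤ) • (y + e κ) - halfVec L ≤ z → z + e μ ≤ (L : ℤ) • (y + e κ) + halfVec L →
      ‖(avgIterZ L (mgauge U₀ u U₁ * U₀) j z μ : 𝔸) - (avgIterZ L U₀ j z μ : 𝔸)‖ ≤ α₁)
    (h135b : ‖(avgIterZ L (mgauge U₀ u U₁ * U₀) (j + 1) y κ : 𝔸) - (avgIterZ L U₀ (j + 1) y κ : 𝔸)‖ ≤ α₁) :
    ‖logCovIterZ L U₀ B (j + 1) y κ‖ < 2 * d * L * α₁ := by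
  have hL : Odd L := ⟨s, by omega⟩
  have hL2 : 2 ≤ L := by omega
  have hLr : (0 : ℝ) < (L : ℝ) := by exact_mod_cast (show 0 < L by omega)
  have hpos : 0 < α₀ * (((L : ℝ) ^ (j + 1))⁻¹) ^ 2 := mul_pos hα₀ (pow_pos (inv_pos.mpr (pow_pos hLr (j + 1))) 2)
  set lo : Site d := fun i => (L : ℤ) ^ (j + 1) * y i - (ctrShift L (j + 1) : ℤ) with hlo
  set hi : Site d := fun i => (L : ℤ) ^ (j + 1) * y i + (ctrShift L (j + 1) : ℤ) + if i = κ then (L : ℤ) ^ (j + 1) else 0 with hhi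
  have hlohi : ∀ i, lo i ≤ hi i := lo_le_hi L (j + 1) y κ
  have hU₀1 : ∀ x μ, U₀ x μ ∈ U1 𝔸 := fun x μ => hG.le_U1 (hU₀ x μ)
  set U₀' := clampCfg lo hi U₀ with hU₀'_def
  have hU₀'G : ∀ x μ, U₀' x μ ∈ G := clampCfg_mem hU₀
  have hpdOn : pdevOn lo hi U₀ < α₀ * (((L : ℝ) ^ (j + 1))⁻¹) ^ 2 := by
    refine pdevOn_lt_of_forall hpos fun x μ ν hx hx' => ?_
    rcases eq_or_ne μ ν with rfl | hμν
    · rw [hol_plaqWord_self, Units.val_one, sub_self, norm_zero]; exact hpos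
    · exact h40 x μ ν hμν ⟨hx, hx'⟩
  have hpdev : pdev U₀' < α₀ * (((L : ℝ) ^ (j + 1))⁻¹) ^ 2 := (pdev_clampCfg_le hlohi hU₀1).trans_lt hpdOn
  set Bc : Site d → Fin d → 𝔸 := fun x μ => if lo μ ≤ x μ ∧ x μ < hi μ then B (clamp lo hi x) μ else 0 with hBc_def
  have hexp : clampCfg lo hi (expCfg B) = expCfg Bc := clampCfg_expCfg' lo hi B
  have hBc : ∀ x μ, ‖Bc x μ‖ ≤ b := norm_clampB_le' hlohi hb hB
  have hBcG : ∀ x μ, expCfg Bc x μ ∈ G := fun x μ => by rw [← hexp]; exact clampCfg_mem hBG x μ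
  have hagU : AgreeOn lo hi U₀' U₀ := clampCfg_agree U₀
  have hagEc : AgreeOn lo hi (expCfg Bc) (expCfg B) := by rw [← hexp]; exact clampCfg_agree (expCfg B)
  have hagE : AgreeOn lo hi U₁ (expCfg Bc) := fun x μ hx hxe => by rw [hU₁ x μ hx hxe, hagEc x μ hx hxe]
  have hagB : AgreeOn lo hi B Bc := fun x μ hx hxe => by
    have hr : lo μ ≤ x μ ∧ x μ < hi μ := ⟨(hx μ).1, by have := (hxe μ).2; rw [add_e_apply, if_pos rfl] at this; omega⟩
    simp only [hBc_def, hr, and_self, if_true, clamp_of_inBox hx]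
  set V := expCfg Bc * U₀' with hV_def
  have hVG : ∀ x μ, V x μ ∈ G := fun x μ => by
    rw [hV_def, Pi.mul_apply]; exact G.mul_mem (hBcG x μ) (hU₀'G x μ)
  have hprod : V = clampCfg lo hi (expCfg B * U₀) := by rw [hV_def, clampCfg_mul', hexp]
  have hPU : ∀ x μ, (expCfg B * U₀) x μ ∈ U1 𝔸 := fun x μ => by
    rw [Pi.mul_apply]; exact (U1 𝔸).mul_mem (hG.le_U1 (hBG x μ)) (hU₀1 x μ)
  have hagP : AgreeOn lo hi (expCfg B * U₀) (U₁ * U₀) := B7LocalityGeneral.agreeOn_mul (fun x μ hx hxe => (hU₁ x μ hx hxe).symm)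
    (fun _ _ _ _ => rfl)
  have hpdP : pdevOn lo hi (expCfg B * U₀) < α₀ * (((L : ℝ) ^ (j + 1))⁻¹) ^ 2 := by
    refine pdevOn_lt_of_forall hpos fun x μ ν hx hx' => ?_
    rcases eq_or_ne μ ν with rfl | hμν
    · rw [hol_plaqWord_self, Units.val_one, sub_self, norm_zero]; exact hpos
    · rw [B8Ineq130.hol_plaqWord_congr hagP x μ ν hx hx']
      exact h40' x μ ν hμν ⟨hx, hx'⟩
  have hPV : pdev V < α₀ * (((L : ℝ) ^ (j + 1))⁻¹) ^ 2 := by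
    rw [hprod]; exact (pdev_clampCfg_le hlohi hPU).trans_lt hpdP
  have hfield : mgauge U₀' u (expCfg Bc) * U₀' = gaugeAct u V := mgauge_mul U₀' u (expCfg Bc)
  have havU1 : ∀ j', j' ≤ j + 1 → ∀ x μ, avgIterZ L (mgauge U₀' u (expCfg Bc) * U₀') j' x μ ∈ U1 𝔸 := by
    intro j' hj' x μ
    rw [hfield, avgIterZ_gaugeAct_units]
    have hX := (level_dataZ L hL2 hG (j + 1) V hVG hα₀ hα3 hα4 hPV j' hj').1 x μ
    show uLev L u j' x * avgIterZ L V j' x μ * (uLev L u j' (x + e μ))⁻¹ ∈ U1 𝔸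
    exact (U1 𝔸).mul_mem ((U1 𝔸).mul_mem (uLev_mem hu L j' x) hX) ((U1 𝔸).inv_mem (uLev_mem hu L j' _))
  have hV₀ : ∀ x μ, avgIterZ L U₀' j x μ ∈ U1 𝔸 :=
    (level_dataZ L hL2 hG (j + 1) U₀' hU₀'G hα₀ hα3 hα4 hpdev j (Nat.le_succ j)).1
  have hW₀ : avgIterZ L U₀' (j + 1) y κ ∈ U1 𝔸 :=
    (level_dataZ L hL2 hG (j + 1) U₀' hU₀'G hα₀ hα3 hα4 hpdev (j + 1) le_rfl).1 y κ
  have hId := dbavgCovIterZ_eq_expCfg_logCovIterZ L hLs hs hd hG (j + 1) U₀' hU₀'G hα₀ hα3 hα4 hpdev Bc hb hBc hsm hc₃ j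
    (Nat.le_succ j)
  -- (87): at `c₋` (level `j + 1`) and on the block `B(c₊)` (level `j`)
  have hm' : uLev L u (j + 1) y = (wrecZ L U₀' (expCfg Bc) (j + 1) y)⁻¹ := by
    have hsub : ∀ w, InBox (tlo L y (j + 1)) (thi L y (j + 1)) w → InBox lo hi w := fun w hw =>
      inBox_box_of_tower_fst hL (j + 1) y κ hw
    rw [hm, wrecZ_congr_tower hLs (agreeOn_of_subbox hsub hagU).symm (agreeOn_of_subbox hsub hagE) (j + 1) 0 (by omega) y
      (by rw [B8Ineq130Rec.tlo_zero]) (by rw [B8Ineq130Rec.thi_zero])]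
  have h87' : ∀ x : Site d, InBox ((L : ℤ) • (y + e κ) - halfVec L) ((L : ℤ) • (y + e κ) + halfVec L) x →
      uLev L u j x = (wrecZ L U₀' (expCfg Bc) j x)⁻¹ := by
    intro x hx
    have hx1 : (L : ℤ) • (y + e κ) - halfVec L ≤ x := fun i => (hx i).1
    have hx2 : x ≤ (L : ℤ) • (y + e κ) + halfVec L := fun i => (hx i).2
    have hsub : ∀ w, InBox (tlo L x j) (thi L x j) w → InBox lo hi w := fun w hw =>
      inBox_box_of_tower_snd hL (j + 1) y κ (tower_sub_of_block hLs j hx1 hx2 hw)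
    rw [h87 x hx1 hx2, wrecZ_congr_tower hLs (agreeOn_of_subbox hsub hagU).symm (agreeOn_of_subbox hsub hagE) j 0 (by omega) x
      (by rw [B8Ineq130Rec.tlo_zero]) (by rw [B8Ineq130Rec.thi_zero])]
  -- (1.35): on the level-`j` bonds of `B(c₊)` and at `c`
  have hagF : AgreeOn lo hi (mgauge U₀' u (expCfg Bc) * U₀') (mgauge U₀ u U₁ * U₀) := fun x μ hx hxe => by
    show mgauge U₀' u (expCfg Bc) x μ * U₀' x μ = mgauge U₀ u U₁ x μ * U₀ x μ
    rw [mgauge_apply, mgauge_apply, hagU x μ hx hxe, (hagE x μ hx hxe).symm]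
  have h135' : ∀ (z : Site d) (μ : Fin d), (L : ℤ) • (y + e κ) - halfVec L ≤ z → z + e μ ≤ (L : ℤ) • (y + e κ) + halfVec L →
      ‖(avgIterZ L (mgauge U₀' u (expCfg Bc) * U₀') j z μ : 𝔸) - (avgIterZ L U₀' j z μ : 𝔸)‖ ≤ α₁ := by
    intro z μ hz1 hz2
    rw [avgIterZ_congr hLs j z μ (agreeOn_of_subbox (fun w hw => inBox_box_of_blockBond_snd hLs j y κ hz1 hz2 hw) hagF),
      avgIterZ_congr hLs j z μ (agreeOn_of_subbox (fun w hw => inBox_box_of_blockBond_snd hLs j y κ hz1 hz2 hw) hagU)]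
    exact h135 z μ hz1 hz2
  have h135b' : ‖(avgIterZ L (mgauge U₀' u (expCfg Bc) * U₀') (j + 1) y κ : 𝔸) - (avgIterZ L U₀' (j + 1) y κ : 𝔸)‖ ≤ α₁ := by
    rw [avgIterZ_congr hLs (j + 1) y κ hagF, avgIterZ_congr hLs (j + 1) y κ hagU]; exact h135b
  have key := norm_Qj_lt_crossing_mirrored hLs hd U₀' Bc u j hId y κ hm' (fun x hx => h87' x hx) (havU1 j (Nat.le_succ j)) hV₀
    (havU1 (j + 1) le_rfl y κ) hW₀ hα hsmall h135' h135b'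
  rwa [logCovIterZ_congr hLs (j + 1) y κ hagU hagB.symm] at key

end Crossing

end Literature.MathematicalPhysics.QuantumFieldTheory.Balaban1983to89.B8Eq142KLevelLocalRec

end
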